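import Summits.ValiantsHypothesis.ValiantsHypothesis.Theorems.SymPencilPerFourInnerRankRows

/-!
# Route `SymPencil` — the `3 × 3` minors of a symmetric zero-diagonal `4 × 4` matrix and the
# corank-two dichotomy STAR / BIPARTITE (`--supports` stmt-ValiantsHypothesis-5674
# `SdcSuperquadratic`; algebra for `SymPencilPerFourTwoRowCorankTwo`; rung currency only)

For six scalars `a = m₀₁, b = m₀₂, c = m₀₃, d = m₁₂, e = m₁₃, f = m₂₃` let
`P = [[0,f,e,d],[f,0,c,b],[e,c,0,a],[d,b,a,0]]` (`P_{kl} = m_{{k,l}ᶜ}`; for `m_{ij} = α_i β_j +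
α_j β_i` this is the pairing matrix of the rows `α, β`, `SymPencilPerFourRowPairing.det_pairing_eq`).
The ten `3 × 3` minors are `2cef, 2bdf, 2ade, 2abc` (principal) and `x · (± af ± be ± cd)`
(`minor_…`), and their vanishing (corank `≥ 2`) forces (`star_or_bipartite`): a STAR — some index
`i` with `m_{ij} = 0` for all `j` — or a BIPARTITE pattern — `m` vanishes on a perfect matching
`{S, Sᶜ}` and is rank one across it.  (Equivalently: the rank-`≤ 2` symmetric zero-diagonal
matrices are `v wᵀ + w vᵀ` with disjoint supports.)

Honest framing: pure algebra; the crux `SdcSuperquadratic` and `VP ≠ VNP` untouched.  No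
definitions, no named facts. [folklore]
-/

noncomputable section

-- single-conjunct layout: Sub = Summit, duplicated namespace component intended
set_option linter.dupNamespace false

namespace Summit.ValiantsHypothesis.ValiantsHypothesis.Theorems.SymPencilPerFourPairingMinors

variable {K : Type*} [Field K]

/-! ### The `3 × 3` minors of a symmetric zero-diagonal `4 × 4` matrix -/

/-- A `3 × 3` minor of `[[0,f,e,d],[f,0,c,b],[e,c,0,a],[d,b,a,0]]` (rows `![0, 1, 2]`, columns `![0, 1, 2]`).
[folklore] -/
theorem minor_012_012 (a b c d e f : K) :
    ((Matrix.of ![![0, f, e, d], ![f, 0, c, b], ![e, c, 0, a], ![d, b, a, 0]] : Matrix (Fin 4) (Fin 4) K).submatrix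
      ![0, 1, 2] ![0, 1, 2]).det = 2 * c * e * f := by
  simp [Matrix.det_fin_three]
  ring

/-- A `3 × 3` minor of `[[0,f,e,d],[f,0,c,b],[e,c,0,a],[d,b,a,0]]` (rows `![0, 1, 2]`, columns `![0, 1, 3]`).
[folklore] -/
theorem minor_012_013 (a b c d e f : K) :
    ((Matrix.of ![![0, f, e, d], ![f, 0, c, b], ![e, c, 0, a], ![d, b, a, 0]] : Matrix (Fin 4) (Fin 4) K).submatrix
      ![0, 1, 2] ![0, 1, 3]).det = f * (b * e + c * d - a * f) := by
  simp [Matrix.det_fin_three]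
  ring

/-- A `3 × 3` minor of `[[0,f,e,d],[f,0,c,b],[e,c,0,a],[d,b,a,0]]` (rows `![0, 1, 2]`, columns `![0, 2, 3]`).
[folklore] -/
theorem minor_012_023 (a b c d e f : K) :
    ((Matrix.of ![![0, f, e, d], ![f, 0, c, b], ![e, c, 0, a], ![d, b, a, 0]] : Matrix (Fin 4) (Fin 4) K).submatrix
      ![0, 1, 2] ![0, 2, 3]).det = e * (b * e - a * f - c * d) := by
  simp [Matrix.det_fin_three]
  ring

/-- A `3 × 3` minor of `[[0,f,e,d],[f,0,c,b],[e,c,0,a],[d,b,a,0]]` (rows `![0, 1, 2]`, columns `![1, 2, 3]`).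
[folklore] -/
theorem minor_012_123 (a b c d e f : K) :
    ((Matrix.of ![![0, f, e, d], ![f, 0, c, b], ![e, c, 0, a], ![d, b, a, 0]] : Matrix (Fin 4) (Fin 4) K).submatrix
      ![0, 1, 2] ![1, 2, 3]).det = c * (a * f + b * e - c * d) := by
  simp [Matrix.det_fin_three]
  ring

/-- A `3 × 3` minor of `[[0,f,e,d],[f,0,c,b],[e,c,0,a],[d,b,a,0]]` (rows `![0, 1, 3]`, columns `![0, 1, 3]`).
[folklore] -/
theorem minor_013_013 (a b c d e f : K) :
    ((Matrix.of ![![0, f, e, d], ![f, 0, c, b], ![e, c, 0, a], ![d, b, a, 0]] : Matrix (Fin 4) (Fin 4) K).submatrix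
      ![0, 1, 3] ![0, 1, 3]).det = 2 * b * d * f := by
  simp [Matrix.det_fin_three]
  ring

/-- A `3 × 3` minor of `[[0,f,e,d],[f,0,c,b],[e,c,0,a],[d,b,a,0]]` (rows `![0, 1, 3]`, columns `![0, 2, 3]`).
[folklore] -/
theorem minor_013_023 (a b c d e f : K) :
    ((Matrix.of ![![0, f, e, d], ![f, 0, c, b], ![e, c, 0, a], ![d, b, a, 0]] : Matrix (Fin 4) (Fin 4) K).submatrix
      ![0, 1, 3] ![0, 2, 3]).det = d * (a * f + b * e - c * d) := by
  simp [Matrix.det_fin_three]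
  ring

/-- A `3 × 3` minor of `[[0,f,e,d],[f,0,c,b],[e,c,0,a],[d,b,a,0]]` (rows `![0, 1, 3]`, columns `![1, 2, 3]`).
[folklore] -/
theorem minor_013_123 (a b c d e f : K) :
    ((Matrix.of ![![0, f, e, d], ![f, 0, c, b], ![e, c, 0, a], ![d, b, a, 0]] : Matrix (Fin 4) (Fin 4) K).submatrix
      ![0, 1, 3] ![1, 2, 3]).det = b * (b * e - a * f - c * d) := by
  simp [Matrix.det_fin_three]
  ring

/-- A `3 × 3` minor of `[[0,f,e,d],[f,0,c,b],[e,c,0,a],[d,b,a,0]]` (rows `![0, 2, 3]`, columns `![0, 2, 3]`).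
[folklore] -/
theorem minor_023_023 (a b c d e f : K) :
    ((Matrix.of ![![0, f, e, d], ![f, 0, c, b], ![e, c, 0, a], ![d, b, a, 0]] : Matrix (Fin 4) (Fin 4) K).submatrix
      ![0, 2, 3] ![0, 2, 3]).det = 2 * a * d * e := by
  simp [Matrix.det_fin_three]
  ring

/-- A `3 × 3` minor of `[[0,f,e,d],[f,0,c,b],[e,c,0,a],[d,b,a,0]]` (rows `![0, 2, 3]`, columns `![1, 2, 3]`).
[folklore] -/
theorem minor_023_123 (a b c d e f : K) :
    ((Matrix.of ![![0, f, e, d], ![f, 0, c, b], ![e, c, 0, a], ![d, b, a, 0]] : Matrix (Fin 4) (Fin 4) K).submatrix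
      ![0, 2, 3] ![1, 2, 3]).det = a * (b * e + c * d - a * f) := by
  simp [Matrix.det_fin_three]
  ring

/-- A `3 × 3` minor of `[[0,f,e,d],[f,0,c,b],[e,c,0,a],[d,b,a,0]]` (rows `![1, 2, 3]`, columns `![1, 2, 3]`).
[folklore] -/
theorem minor_123_123 (a b c d e f : K) :
    ((Matrix.of ![![0, f, e, d], ![f, 0, c, b], ![e, c, 0, a], ![d, b, a, 0]] : Matrix (Fin 4) (Fin 4) K).submatrix
      ![1, 2, 3] ![1, 2, 3]).det = 2 * a * b * c := by
  simp [Matrix.det_fin_three]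
  ring

/-! ### Corank two: star or bipartite -/

/-- **Rank `≤ 2` symmetric zero-diagonal `4 × 4` matrices are stars or bipartite.**  With
`a = m₀₁, b = m₀₂, c = m₀₃, d = m₁₂, e = m₁₃, f = m₂₃` and the matrix
`P = [[0,f,e,d],[f,0,c,b],[e,c,0,a],[d,b,a,0]]` (`P_{kl} = m_{{k,l}ᶜ}`), the vanishing of the ten
`3 × 3` minors forces: a STAR (`m_{ij} = 0` for all `j`, some `i`) or a BIPARTITE pattern
(`m` vanishes on a perfect matching and is rank one across it). [folklore] -/
theorem star_or_bipartite [CharZero K] {a b c d e f : K}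
    (h1 : 2 * a * b * c = 0) (h2 : 2 * a * d * e = 0) (h3 : 2 * b * d * f = 0)
    (h4 : 2 * c * e * f = 0)
    (h5 : a * (b * e + c * d - a * f) = 0) (h6 : f * (b * e + c * d - a * f) = 0)
    (h7 : b * (b * e - a * f - c * d) = 0) (h8 : e * (b * e - a * f - c * d) = 0)
    (h9 : c * (a * f + b * e - c * d) = 0) (h10 : d * (a * f + b * e - c * d) = 0) :
    (a = 0 ∧ b = 0 ∧ c = 0) ∨ (a = 0 ∧ d = 0 ∧ e = 0) ∨ (b = 0 ∧ d = 0 ∧ f = 0) ∨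
      (c = 0 ∧ e = 0 ∧ f = 0) ∨
    (a = 0 ∧ f = 0 ∧ b * e = c * d) ∨ (b = 0 ∧ e = 0 ∧ a * f = c * d) ∨
      (c = 0 ∧ d = 0 ∧ a * f = b * e) := by
  have two : (2 : K) ≠ 0 := two_ne_zero
  by_cases ha : a = 0
  · subst ha
    by_cases hf : f = 0
    · subst hf
      by_cases hbe : b * e = c * d
      · exact Or.inr (Or.inr (Or.inr (Or.inr (Or.inl ⟨rfl, rfl, hbe⟩))))
      · -- `b (b e - c d) = 0`, `c (b e - c d) = 0`
        have hne : b * e - c * d ≠ 0 := sub_ne_zero.2 hbe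
        have hb : b = 0 := by
          have h : b * (b * e - c * d) = 0 := by linear_combination h7
          exact (mul_eq_zero.1 h).resolve_right hne
        have hc : c = 0 := by
          have h : c * (b * e - c * d) = 0 := by linear_combination h9
          exact (mul_eq_zero.1 h).resolve_right hne
        exact Or.inl ⟨rfl, hb, hc⟩
    · -- `a = 0`, `f ≠ 0`: `b e + c d = 0`, `b d = 0`, `c e = 0`
      have hsum : b * e + c * d = 0 := by
        have h : f * (b * e + c * d) = 0 := by linear_combination h6
        exact (mul_eq_zero.1 h).resolve_left hf
      have hbd : b * d = 0 := by
        have h : (2 * f) * (b * d) = 0 := by linear_combination h3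
        exact (mul_eq_zero.1 h).resolve_left (mul_ne_zero two hf)
      have hce : c * e = 0 := by
        have h : (2 * f) * (c * e) = 0 := by linear_combination h4
        exact (mul_eq_zero.1 h).resolve_left (mul_ne_zero two hf)
      by_cases hb : b = 0
      · subst hb
        have hcd : c * d = 0 := by linear_combination hsum
        rcases mul_eq_zero.1 hcd with hc | hd
        · exact Or.inl ⟨rfl, rfl, hc⟩
        · subst hd
          rcases mul_eq_zero.1 hce with hc | he
          · exact Or.inl ⟨rfl, rfl, hc⟩
          · exact Or.inr (Or.inl ⟨rfl, rfl, he⟩)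
      · have hd : d = 0 := (mul_eq_zero.1 hbd).resolve_left hb
        subst hd
        have he : e = 0 := by
          have h : b * e = 0 := by linear_combination hsum
          exact (mul_eq_zero.1 h).resolve_left hb
        exact Or.inr (Or.inl ⟨rfl, rfl, he⟩)
  · -- `a ≠ 0`: `b c = 0`, `d e = 0`, `a f = b e + c d`
    have hbc : b * c = 0 := by
      have h : (2 * a) * (b * c) = 0 := by linear_combination h1
      exact (mul_eq_zero.1 h).resolve_left (mul_ne_zero two ha)
    have hde : d * e = 0 := by
      have h : (2 * a) * (d * e) = 0 := by linear_combination h2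
      exact (mul_eq_zero.1 h).resolve_left (mul_ne_zero two ha)
    have haf : a * f = b * e + c * d := by
      have h : a * (b * e + c * d - a * f) = 0 := h5
      have h' := (mul_eq_zero.1 h).resolve_left ha
      linear_combination -h'
    by_cases hb : b = 0
    · subst hb
      rcases mul_eq_zero.1 hde with hd | he
      · subst hd
        have hf : f = 0 := by
          have h : a * f = 0 := by linear_combination haf
          exact (mul_eq_zero.1 h).resolve_left ha
        exact Or.inr (Or.inr (Or.inl ⟨rfl, rfl, hf⟩))
      · exact Or.inr (Or.inr (Or.inr (Or.inr (Or.inr (Or.inl ⟨rfl, he, by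
          linear_combination haf⟩)))))
    · have hc : c = 0 := (mul_eq_zero.1 hbc).resolve_left hb
      subst hc
      rcases mul_eq_zero.1 hde with hd | he
      · exact Or.inr (Or.inr (Or.inr (Or.inr (Or.inr (Or.inr ⟨rfl, hd, by
          linear_combination haf⟩)))))
      · subst he
        have hf : f = 0 := by
          have h : a * f = 0 := by linear_combination haf
          exact (mul_eq_zero.1 h).resolve_left ha
        exact Or.inr (Or.inr (Or.inr (Or.inl ⟨rfl, rfl, hf⟩)))

end Summit.ValiantsHypothesis.ValiantsHypothesis.Theorems.SymPencilPerFourPairingMinors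

end
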